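import Summits.Ventures.Crystal3D.Theorems.StickyWulffConstantNoReconstructionGainPredSlotBudgetRaisedThreeCover
import Summits.Ventures.Crystal3D.Theorems.StickyWulffConstantNoReconstructionGainPredSlotBudgetRaisedThreeCone
import Summits.Ventures.Crystal3D.Theorems.StickyWulffConstantNoReconstructionGainPredSlotBudgetRaisedThreeFacts
import Summits.Ventures.Crystal3D.Theorems.StickyWulffConstantNoReconstructionGainPredSlotBudgetRaisedThreeCert
import HarnessLib

/-!
# Raised up bond, three contacts: the excluded azimuth regions (regime II)

HONEST FRAMING. Part of the venture `Summits/Ventures/Crystal3D` (cell `crystal3d-full`), helper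
`--supports` the crux `NoReconstructionGain` (stmt-Ventures-19144, route
`route-Ventures-StickyWulffConstant`), line `adhesion` (wulff-p1 g15).  Frame `n = (a,b,c)` in region
R ∩ regime II (integer constraints of `regionII_bounds`), a contact `U = (x,y,z)` (`|U|² = 2`, depth
`> T₀ = b + c`) avoiding the caps of `W₁ = (0,1,1)`, `W₂ = (−1,0,1)`, `B₁ = (1,1,0)`.  The tangent
direction of `U` cannot lie in any of the following regions (`ar(X,Y) = det[X,Y,n]`; the conic sign
hypotheses `hl`, `hm` are those of `m1_of_between`, the separation hypothesis `hsep` that of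
`twoCap_false`):
* `regionS_false` — wedge from `B̃_S = R_{W₂}(W₁)` (scaled) to `W₂`, lens vertices `P* = (1,−1,4)/3`,
  `W₃ = (−1,1,0)` separated (two-cap template `C = W₂`, `W = W₁`);
* `regionN_false` — wedge from `B̃_N = R_{B₁}(W₁)` to `B₁`, `B₂`, `P_N = (−1,4,−1)/3` separated (`C = B₁`);
* `regionW1_false` — wedge from `W₁` to `B₁`, same lens (`C = B₁`, reference `W₁`);
* `zoneW1_false` — wedge between `W₁` and `P̃_N = (−1,4,−1)`: within azimuth `g₀` of the pole cap
  (`conic_mono` + `cert_f13` + `poleCap_false`).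
(The west wedge `cone[W₂, W₁]` is `westWedge_false` of `…RaisedThreeTangent`.)

WHAT THIS IS NOT: the classification of a contact and the pair step (next file); rung F-C1 not moved.
-/

namespace Summit.Ventures.Crystal3D.Theorems


/-- **South template region.**  A contact inside the wedge from `B̃_S` to `W₂` (nonzero `W₂`-component), whose meridian separates `P*` and `W₃`, lies in `cap(W₂) ∪ cap(W₁)` — contradiction. -/
theorem regionS_false {a b c x y z : ℝ} (hn : a ^ 2 + b ^ 2 + c ^ 2 = 2) (hu : x ^ 2 + y ^ 2 + z ^ 2 = 2)
    (hg1 : 0 ≤ -b + a) (hg2 : 0 ≤ b + a) (hg3 : 0 ≤ -209 + 256 * c + 256 * b - 256 * a)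
    (hg4 : 0 ≤ 2 - c ^ 2 - 2 * b * c - b ^ 2) (hg5 : 0 ≤ 5 - 8 * a) (hg6 : 0 ≤ -9 + 8 * c)
    (hdT : b + c < a * x + b * y + c * z) (hUW2 : -x + z ≤ 1) (hUW1 : y + z ≤ 1)
    (hl : 0 ≤ (x * (0 * c - 1 * b) - y * ((-1) * c - 1 * a) + z * ((-1) * b - 0 * a)) *
      ((2 * b * c - 2 * b ^ 2 + 2 * a * b) * (0 * c - 1 * b) - (-c ^ 2 + 2 * b * c + 2 * b ^ 2 - 2 * a * c + 2 * a * b - a ^ 2) * ((-1) * c - 1 * a) + (c ^ 2 + 2 * b * c + 2 * a * c + 2 * a * b + a ^ 2) * ((-1) * b - 0 * a)))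
    (hm : 0 < ((2 * b * c - 2 * b ^ 2 + 2 * a * b) * (y * c - z * b) - (-c ^ 2 + 2 * b * c + 2 * b ^ 2 - 2 * a * c + 2 * a * b - a ^ 2) * (x * c - z * a) + (c ^ 2 + 2 * b * c + 2 * a * c + 2 * a * b + a ^ 2) * (x * b - y * a)) *
      ((2 * b * c - 2 * b ^ 2 + 2 * a * b) * (0 * c - 1 * b) - (-c ^ 2 + 2 * b * c + 2 * b ^ 2 - 2 * a * c + 2 * a * b - a ^ 2) * ((-1) * c - 1 * a) + (c ^ 2 + 2 * b * c + 2 * a * c + 2 * a * b + a ^ 2) * ((-1) * b - 0 * a)))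
    (hsep : ((1 / 3) * (b * z - c * y) + (-1 / 3) * (c * x - a * z) + (4 / 3) * (a * y - b * x)) * ((-1) * (b * z - c * y) + 1 * (c * x - a * z) + 0 * (a * y - b * x)) < 0) : False := by
  have hT0 : 1 < b + c := by have := cert_T0m1 hn hg1 hg2 hg3 hg4; linarith only [this]
  have hs : (0:ℝ) < c ^ 2 + 2 * b ^ 2 + 2 * a * c + a ^ 2 := by nlinarith only [hg1, hg2, hg6, sq_nonneg b, sq_nonneg (a + c)]
  have hKc : 0 ≤ 2 - (b + c) * (c - a) := by have := fact_hKcS hn hg2 hg4 hg6; nlinarith only [this, hn]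
  have hA : 0 < 4 - (c - a) ^ 2 := by
    have hc2 : c ^ 2 ≤ 2 := by nlinarith only [hn, sq_nonneg a, sq_nonneg b]
    have h1 : 0 < 2 - (c - a) := by nlinarith only [hc2, hg1, hg2, hg6]
    have h2 : 0 < 2 + (c - a) := by linarith only [hg5, hg6]
    nlinarith only [mul_pos h1 h2]
  have hdet : (2 - (b + c) * (c - a)) ^ 2 < (4 - (c - a) ^ 2) * (4 - (b + c) ^ 2) := by
    have := fact_hdet hg1 hg2 hg5 hg6; nlinarith only [this, hn]
  obtain ⟨hQ, hM1⟩ := m1_of_between (k₁ := 2 * b * c - 2 * b ^ 2 + 2 * a * b) (k₂ := -c ^ 2 + 2 * b * c + 2 * b ^ 2 - 2 * a * c + 2 * a * b - a ^ 2)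
    (k₃ := c ^ 2 + 2 * b * c + 2 * a * c + 2 * a * b + a ^ 2) (c₁ := (-1)) (c₂ := 0) (c₃ := 1) (d := (a * x + b * y + c * z))
    (T₀ := b + c) (dC := c - a) (s := c ^ 2 + 2 * b ^ 2 + 2 * a * c + a ^ 2) hn hu rfl (by norm_num) (by ring) hs (by ring) (by ring) (by ring)
    hKc hA hdet hl hm
  have ekC : 2 * ((-x + z) - (a * x + b * y + c * z) * (c - a) / 2) = (2 * (x * (-1) + y * 0 + z * 1) - (a * x + b * y + c * z) * (c - a)) := by ring
  have hkC0 : 0 < ((-x + z) - (a * x + b * y + c * z) * (c - a) / 2) := by linarith only [hQ, ekC]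
  have hM1' : (2 - (b + c) * (c - a)) ^ 2 * (4 - (a * x + b * y + c * z) ^ 2) < (2 * ((-x + z) - (a * x + b * y + c * z) * (c - a) / 2)) ^ 2 * (4 - (b + c) ^ 2) := by
    rw [ekC]; exact hM1
  have hUC : (a * x + b * y + c * z) * (c - a) / 2 + ((-x + z) - (a * x + b * y + c * z) * (c - a) / 2) ≤ 1 := by linarith only [hUW2]
  have hUW : (a * x + b * y + c * z) * (b + c) / 2 + ((y + z) - (a * x + b * y + c * z) * (b + c) / 2) ≤ 1 := by linarith only [hUW1]
  have hdC : (0:ℝ) ≤ c - a := by linarith only [hg2, hg5, hg6]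
  exact twoCap_false (c₁ := (-1)) (c₂ := 0) (c₃ := 1) (w₁ := 0) (w₂ := 1) (w₃ := 1) (p₁ := (1 / 3)) (p₂ := (-1 / 3))
    (p₃ := (4 / 3)) (q₁ := (-1)) (q₂ := 1) (q₃ := 0) (d := (a * x + b * y + c * z)) (T₀ := b + c) (dC := c - a)
    (kC := ((-x + z) - (a * x + b * y + c * z) * (c - a) / 2)) (kW := ((y + z) - (a * x + b * y + c * z) * (b + c) / 2))
    hn hu (by norm_num) rfl (by ring) (by ring) (by ring) (by ring) hT0 hdT hdC hUC hUW hkC0 hM1'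
    (by norm_num) (by norm_num) (by norm_num) (by norm_num) (by norm_num) (by norm_num) (by norm_num) hsep


/-- **North template region (reference `B̃_N`).**  A contact inside the wedge from `B̃_N` to `B₁` (nonzero `B₁`-component) whose meridian separates `B₂` and `P_N` lies in `cap(B₁) ∪ cap(W₁)`. -/
theorem regionN_false {a b c x y z : ℝ} (hn : a ^ 2 + b ^ 2 + c ^ 2 = 2) (hu : x ^ 2 + y ^ 2 + z ^ 2 = 2)
    (hg1 : 0 ≤ -b + a) (hg2 : 0 ≤ b + a) (hg3 : 0 ≤ -209 + 256 * c + 256 * b - 256 * a)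
    (hg4 : 0 ≤ 2 - c ^ 2 - 2 * b * c - b ^ 2) (hg5 : 0 ≤ 5 - 8 * a) (hg6 : 0 ≤ -9 + 8 * c) (hg7 : 0 ≤ 5 - 16 * b)
    (hdT : b + c < a * x + b * y + c * z) (hUB1 : x + y ≤ 1) (hUW1 : y + z ≤ 1)
    (hl : 0 ≤ (x * (1 * c - 0 * b) - y * (1 * c - 0 * a) + z * (1 * b - 1 * a)) *
      ((2 * c ^ 2 - 2 * b * c + 2 * a * c) * (1 * c - 0 * b) - (4 - 2 * c ^ 2 + 2 * b * c - b ^ 2 - 2 * a * c - 2 * a * b - a ^ 2) * (1 * c - 0 * a) + (4 + 2 * b * c - 3 * b ^ 2 - 2 * a * c + 2 * a * b - 3 * a ^ 2) * (1 * b - 1 * a)))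
    (hm : 0 < ((2 * c ^ 2 - 2 * b * c + 2 * a * c) * (y * c - z * b) - (4 - 2 * c ^ 2 + 2 * b * c - b ^ 2 - 2 * a * c - 2 * a * b - a ^ 2) * (x * c - z * a) + (4 + 2 * b * c - 3 * b ^ 2 - 2 * a * c + 2 * a * b - 3 * a ^ 2) * (x * b - y * a)) *
      ((2 * c ^ 2 - 2 * b * c + 2 * a * c) * (1 * c - 0 * b) - (4 - 2 * c ^ 2 + 2 * b * c - b ^ 2 - 2 * a * c - 2 * a * b - a ^ 2) * (1 * c - 0 * a) + (4 + 2 * b * c - 3 * b ^ 2 - 2 * a * c + 2 * a * b - 3 * a ^ 2) * (1 * b - 1 * a)))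
    (hsep : (1 * (b * z - c * y) + 0 * (c * x - a * z) + 1 * (a * y - b * x)) * ((-1 / 3) * (b * z - c * y) + (4 / 3) * (c * x - a * z) + (-1 / 3) * (a * y - b * x)) < 0) : False := by
  have hT0 : 1 < b + c := by have := cert_T0m1 hn hg1 hg2 hg3 hg4; linarith only [this]
  have hs : (0:ℝ) < 4 - b ^ 2 - 2 * a * b - a ^ 2 := by nlinarith only [hg2, hg5, hg7]
  have hKc : 0 ≤ 2 - (b + c) * (a + b) := by have := fact_hKcN hg1 hg2 hg3 hg4 hg5 hg6 hg7; nlinarith only [this]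
  have hA : 0 < 4 - (a + b) ^ 2 := by
    have h1 : 0 < 2 - (a + b) := by linarith only [hg5, hg7]
    have h2 : 0 < 2 + (a + b) := by linarith only [hg2]
    nlinarith only [mul_pos h1 h2]
  have hdet : (2 - (b + c) * (a + b)) ^ 2 < (4 - (a + b) ^ 2) * (4 - (b + c) ^ 2) := by
    have := fact_hdet hg1 hg2 hg5 hg6; nlinarith only [this, hn]
  obtain ⟨hQ, hM1⟩ := m1_of_between (k₁ := 2 * c ^ 2 - 2 * b * c + 2 * a * c) (k₂ := 4 - 2 * c ^ 2 + 2 * b * c - b ^ 2 - 2 * a * c - 2 * a * b - a ^ 2)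
    (k₃ := 4 + 2 * b * c - 3 * b ^ 2 - 2 * a * c + 2 * a * b - 3 * a ^ 2) (c₁ := 1) (c₂ := 1) (c₃ := 0) (d := (a * x + b * y + c * z))
    (T₀ := b + c) (dC := a + b) (s := 4 - b ^ 2 - 2 * a * b - a ^ 2) hn hu rfl (by norm_num) (by ring) hs (by linear_combination (8 * c ^ 2 - 16 * b * c + 8 * b ^ 2 + 16 * a * c - 16 * a * b + 8 * a ^ 2) * hn) (by ring) (by ring)
    hKc hA hdet hl hm
  have ekC : 2 * ((x + y) - (a * x + b * y + c * z) * (a + b) / 2) = (2 * (x * 1 + y * 1 + z * 0) - (a * x + b * y + c * z) * (a + b)) := by ring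
  have hkC0 : 0 < ((x + y) - (a * x + b * y + c * z) * (a + b) / 2) := by linarith only [hQ, ekC]
  have hM1' : (2 - (b + c) * (a + b)) ^ 2 * (4 - (a * x + b * y + c * z) ^ 2) < (2 * ((x + y) - (a * x + b * y + c * z) * (a + b) / 2)) ^ 2 * (4 - (b + c) ^ 2) := by
    rw [ekC]; exact hM1
  have hUC : (a * x + b * y + c * z) * (a + b) / 2 + ((x + y) - (a * x + b * y + c * z) * (a + b) / 2) ≤ 1 := by linarith only [hUB1]
  have hUW : (a * x + b * y + c * z) * (b + c) / 2 + ((y + z) - (a * x + b * y + c * z) * (b + c) / 2) ≤ 1 := by linarith only [hUW1]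
  have hdC : (0:ℝ) ≤ a + b := by linarith only [hg2, hg5, hg6]
  exact twoCap_false (c₁ := 1) (c₂ := 1) (c₃ := 0) (w₁ := 0) (w₂ := 1) (w₃ := 1) (p₁ := 1) (p₂ := 0)
    (p₃ := 1) (q₁ := (-1 / 3)) (q₂ := (4 / 3)) (q₃ := (-1 / 3)) (d := (a * x + b * y + c * z)) (T₀ := b + c) (dC := a + b)
    (kC := ((x + y) - (a * x + b * y + c * z) * (a + b) / 2)) (kW := ((y + z) - (a * x + b * y + c * z) * (b + c) / 2))
    hn hu (by norm_num) rfl (by ring) (by ring) (by ring) (by ring) hT0 hdT hdC hUC hUW hkC0 hM1'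
    (by norm_num) (by norm_num) (by norm_num) (by norm_num) (by norm_num) (by norm_num) (by norm_num) hsep


/-- **North template region (reference `W₁`).**  A contact inside the wedge from `W₁` to `B₁` (nonzero `B₁`-component) whose meridian separates `B₂` and `P_N` lies in `cap(B₁) ∪ cap(W₁)`. -/
theorem regionW1_false {a b c x y z : ℝ} (hn : a ^ 2 + b ^ 2 + c ^ 2 = 2) (hu : x ^ 2 + y ^ 2 + z ^ 2 = 2)
    (hg1 : 0 ≤ -b + a) (hg2 : 0 ≤ b + a) (hg3 : 0 ≤ -209 + 256 * c + 256 * b - 256 * a)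
    (hg4 : 0 ≤ 2 - c ^ 2 - 2 * b * c - b ^ 2) (hg5 : 0 ≤ 5 - 8 * a) (hg6 : 0 ≤ -9 + 8 * c) (hg7 : 0 ≤ 5 - 16 * b)
    (hdT : b + c < a * x + b * y + c * z) (hUB1 : x + y ≤ 1) (hUW1 : y + z ≤ 1)
    (hl : 0 ≤ (x * (1 * c - 0 * b) - y * (1 * c - 0 * a) + z * (1 * b - 1 * a)) *
      ((0) * (1 * c - 0 * b) - (1) * (1 * c - 0 * a) + (1) * (1 * b - 1 * a)))
    (hm : 0 < ((0) * (y * c - z * b) - (1) * (x * c - z * a) + (1) * (x * b - y * a)) *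
      ((0) * (1 * c - 0 * b) - (1) * (1 * c - 0 * a) + (1) * (1 * b - 1 * a)))
    (hsep : (1 * (b * z - c * y) + 0 * (c * x - a * z) + 1 * (a * y - b * x)) * ((-1 / 3) * (b * z - c * y) + (4 / 3) * (c * x - a * z) + (-1 / 3) * (a * y - b * x)) < 0) : False := by
  have hT0 : 1 < b + c := by have := cert_T0m1 hn hg1 hg2 hg3 hg4; linarith only [this]
  have hs : (0:ℝ) < 1 := by norm_num
  have hKc : 0 ≤ 2 - (b + c) * (a + b) := by have := fact_hKcN hg1 hg2 hg3 hg4 hg5 hg6 hg7; nlinarith only [this]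
  have hA : 0 < 4 - (a + b) ^ 2 := by
    have h1 : 0 < 2 - (a + b) := by linarith only [hg5, hg7]
    have h2 : 0 < 2 + (a + b) := by linarith only [hg2]
    nlinarith only [mul_pos h1 h2]
  have hdet : (2 - (b + c) * (a + b)) ^ 2 < (4 - (a + b) ^ 2) * (4 - (b + c) ^ 2) := by
    have := fact_hdet hg1 hg2 hg5 hg6; nlinarith only [this, hn]
  obtain ⟨hQ, hM1⟩ := m1_of_between (k₁ := 0) (k₂ := 1)
    (k₃ := 1) (c₁ := 1) (c₂ := 1) (c₃ := 0) (d := (a * x + b * y + c * z))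
    (T₀ := b + c) (dC := a + b) (s := 1) hn hu rfl (by norm_num) (by ring) hs (by norm_num) (by ring) (by ring)
    hKc hA hdet hl hm
  have ekC : 2 * ((x + y) - (a * x + b * y + c * z) * (a + b) / 2) = (2 * (x * 1 + y * 1 + z * 0) - (a * x + b * y + c * z) * (a + b)) := by ring
  have hkC0 : 0 < ((x + y) - (a * x + b * y + c * z) * (a + b) / 2) := by linarith only [hQ, ekC]
  have hM1' : (2 - (b + c) * (a + b)) ^ 2 * (4 - (a * x + b * y + c * z) ^ 2) < (2 * ((x + y) - (a * x + b * y + c * z) * (a + b) / 2)) ^ 2 * (4 - (b + c) ^ 2) := by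
    rw [ekC]; exact hM1
  have hUC : (a * x + b * y + c * z) * (a + b) / 2 + ((x + y) - (a * x + b * y + c * z) * (a + b) / 2) ≤ 1 := by linarith only [hUB1]
  have hUW : (a * x + b * y + c * z) * (b + c) / 2 + ((y + z) - (a * x + b * y + c * z) * (b + c) / 2) ≤ 1 := by linarith only [hUW1]
  have hdC : (0:ℝ) ≤ a + b := by linarith only [hg2, hg5, hg6]
  exact twoCap_false (c₁ := 1) (c₂ := 1) (c₃ := 0) (w₁ := 0) (w₂ := 1) (w₃ := 1) (p₁ := 1) (p₂ := 0)
    (p₃ := 1) (q₁ := (-1 / 3)) (q₂ := (4 / 3)) (q₃ := (-1 / 3)) (d := (a * x + b * y + c * z)) (T₀ := b + c) (dC := a + b)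
    (kC := ((x + y) - (a * x + b * y + c * z) * (a + b) / 2)) (kW := ((y + z) - (a * x + b * y + c * z) * (b + c) / 2))
    hn hu (by norm_num) rfl (by ring) (by ring) (by ring) (by ring) hT0 hdT hdC hUC hUW hkC0 hM1'
    (by norm_num) (by norm_num) (by norm_num) (by norm_num) (by norm_num) (by norm_num) (by norm_num) hsep


/-- **Pole-cap zone.**  A contact whose tangent direction lies in the wedge between `W₁` and `P̃_N`
(conic sign data w.r.t. the generators `(P̃_N, W₁)`, `ar(P̃_N,W₁) ≠ 0`) is within azimuth `g₀` of `W₁`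
(`conic_mono` + `cert_f13`), hence in `cap(W₁)` (`poleCap_false`) — contradiction. -/
theorem zoneW1_false {a b c x y z : ℝ} (hn : a ^ 2 + b ^ 2 + c ^ 2 = 2) (hu : x ^ 2 + y ^ 2 + z ^ 2 = 2)
    (hg1 : 0 ≤ -b + a) (hg2 : 0 ≤ b + a) (hg3 : 0 ≤ -209 + 256 * c + 256 * b - 256 * a)
    (hg4 : 0 ≤ 2 - c ^ 2 - 2 * b * c - b ^ 2) (hg5 : 0 ≤ 5 - 8 * a) (hg6 : 0 ≤ -9 + 8 * c)
    (hII : (b + c) ^ 2 < 2) (hdT : b + c < a * x + b * y + c * z) (hUW1 : y + z ≤ 1)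
    (hD : (((-1)) * (1 * c - 1 * b) - (4) * (0 * c - 1 * a) + ((-1)) * (0 * b - 1 * a)) ≠ 0)
    (hl : 0 ≤ (x * (1 * c - 1 * b) - y * (0 * c - 1 * a) + z * (0 * b - 1 * a)) * (((-1)) * (1 * c - 1 * b) - (4) * (0 * c - 1 * a) + ((-1)) * (0 * b - 1 * a)))
    (hm : 0 ≤ (((-1)) * (y * c - z * b) - (4) * (x * c - z * a) + ((-1)) * (x * b - y * a)) * (((-1)) * (1 * c - 1 * b) - (4) * (0 * c - 1 * a) + ((-1)) * (0 * b - 1 * a))) : False := by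
  have hT0 : 1 < b + c := by have := cert_T0m1 hn hg1 hg2 hg3 hg4; linarith only [this]
  obtain ⟨C1, C2⟩ := cramer_pair hn (-1) 4 (-1) 0 1 1 x y z
  have eKc : (2 * ((-1) * 0 + 4 * 1 + (-1) * 1) - (a * (-1) + b * 4 + c * (-1)) * (a * 0 + b * 1 + c * 1)) = 8 - 3 * b * c - 5 * b ^ 2 + a * c + a * b - a ^ 2 := by linear_combination hn
  have eKK : (2 * ((-1) * (-1) + 4 * 4 + (-1) * (-1)) - (a * (-1) + b * 4 + c * (-1)) * (a * (-1) + b * 4 + c * (-1))) = 34 + 8 * b * c - 15 * b ^ 2 - 2 * a * c + 8 * a * b := by linear_combination (-1 : ℝ) * hn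
  have eA : (2 * (0 * 0 + 1 * 1 + 1 * 1) - (a * 0 + b * 1 + c * 1) * (a * 0 + b * 1 + c * 1)) = 4 - (b + c) ^ 2 := by ring
  have eUU : (2 * (x * x + y * y + z * z) - (a * x + b * y + c * z) * (a * x + b * y + c * z)) = 4 - (a * x + b * y + c * z) ^ 2 := by nlinarith only [hu]
  rw [eKc] at C1 C2
  rw [eKK] at C2
  rw [eA] at C1 C2
  rw [eUU] at C2
  have hKc : (0:ℝ) ≤ 8 - 3 * b * c - 5 * b ^ 2 + a * c + a * b - a ^ 2 := (fact_f12 hn hg1 hg2 hg3 hg4 hg6).le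
  have hKK : (0:ℝ) < 34 + 8 * b * c - 15 * b ^ 2 - 2 * a * c + 8 * a * b := fact_f14 hn hg1 hg2 hg3 hg5 hg6
  have hA : 0 < 4 - (b + c) ^ 2 := by nlinarith only [hII]
  have G := tangent_gram a b c (-1) 4 (-1) 0 1 1
  rw [hn] at G
  have hdet : (8 - 3 * b * c - 5 * b ^ 2 + a * c + a * b - a ^ 2) ^ 2 ≤
      (4 - (b + c) ^ 2) * (34 + 8 * b * c - 15 * b ^ 2 - 2 * a * c + 8 * a * b) := by
    nlinarith only [G, eKc, eKK, eA, sq_nonneg (((-1)) * (1 * c - 1 * b) - (4) * (0 * c - 1 * a) + ((-1)) * (0 * b - 1 * a))]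
  -- conic monotonicity, in either orientation of `D = ar(P̃_N, W₁)`
  have key : (8 - 3 * b * c - 5 * b ^ 2 + a * c + a * b - a ^ 2) ^ 2 * (4 - (a * x + b * y + c * z) ^ 2) ≤
      (2 * (x * 0 + y * 1 + z * 1) - (a * x + b * y + c * z) * (a * 0 + b * 1 + c * 1)) ^ 2 * (34 + 8 * b * c - 15 * b ^ 2 - 2 * a * c + 8 * a * b) ∧ 0 ≤ (2 * (x * 0 + y * 1 + z * 1) - (a * x + b * y + c * z) * (a * 0 + b * 1 + c * 1)) := by
    rcases lt_or_gt_of_ne hD with hneg | hpos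
    · have hl' : 0 ≤ -(x * (1 * c - 1 * b) - y * (0 * c - 1 * a) + z * (0 * b - 1 * a)) := by
        by_contra h
        push Not at h
        nlinarith only [hl, mul_pos (by linarith only [h] : 0 < (x * (1 * c - 1 * b) - y * (0 * c - 1 * a) + z * (0 * b - 1 * a))) (neg_pos.2 hneg)]
      have hm' : 0 ≤ -(((-1)) * (y * c - z * b) - (4) * (x * c - z * a) + ((-1)) * (x * b - y * a)) := by
        by_contra h
        push Not at h
        nlinarith only [hm, mul_pos (by linarith only [h] : 0 < (((-1)) * (y * c - z * b) - (4) * (x * c - z * a) + ((-1)) * (x * b - y * a))) (neg_pos.2 hneg)]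
      obtain ⟨h0, h1, -⟩ := conic_mono (D := -(((-1)) * (1 * c - 1 * b) - (4) * (0 * c - 1 * a) + ((-1)) * (0 * b - 1 * a))) (lam := -(x * (1 * c - 1 * b) - y * (0 * c - 1 * a) + z * (0 * b - 1 * a))) (mu := -(((-1)) * (y * c - z * b) - (4) * (x * c - z * a) + ((-1)) * (x * b - y * a))) (A := 4 - (b + c) ^ 2)
        (Kc := 8 - 3 * b * c - 5 * b ^ 2 + a * c + a * b - a ^ 2) (KK := 34 + 8 * b * c - 15 * b ^ 2 - 2 * a * c + 8 * a * b)
        (QUC := (2 * (x * 0 + y * 1 + z * 1) - (a * x + b * y + c * z) * (a * 0 + b * 1 + c * 1))) (QUU := 4 - (a * x + b * y + c * z) ^ 2)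
        hl' hm' hA hKc (neg_pos.2 hneg) hdet (by linear_combination (-1 : ℝ) * C1) (by linear_combination C2)
      exact ⟨h1, h0⟩
    · have hl' : 0 ≤ (x * (1 * c - 1 * b) - y * (0 * c - 1 * a) + z * (0 * b - 1 * a)) := by
        by_contra h
        push Not at h
        nlinarith only [hl, mul_pos (by linarith only [h] : 0 < -(x * (1 * c - 1 * b) - y * (0 * c - 1 * a) + z * (0 * b - 1 * a))) hpos]
      have hm' : 0 ≤ (((-1)) * (y * c - z * b) - (4) * (x * c - z * a) + ((-1)) * (x * b - y * a)) := by
        by_contra h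
        push Not at h
        nlinarith only [hm, mul_pos (by linarith only [h] : 0 < -(((-1)) * (y * c - z * b) - (4) * (x * c - z * a) + ((-1)) * (x * b - y * a))) hpos]
      obtain ⟨h0, h1, -⟩ := conic_mono (D := (((-1)) * (1 * c - 1 * b) - (4) * (0 * c - 1 * a) + ((-1)) * (0 * b - 1 * a))) (lam := (x * (1 * c - 1 * b) - y * (0 * c - 1 * a) + z * (0 * b - 1 * a))) (mu := (((-1)) * (y * c - z * b) - (4) * (x * c - z * a) + ((-1)) * (x * b - y * a))) (A := 4 - (b + c) ^ 2)
        (Kc := 8 - 3 * b * c - 5 * b ^ 2 + a * c + a * b - a ^ 2) (KK := 34 + 8 * b * c - 15 * b ^ 2 - 2 * a * c + 8 * a * b)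
        (QUC := (2 * (x * 0 + y * 1 + z * 1) - (a * x + b * y + c * z) * (a * 0 + b * 1 + c * 1))) (QUU := 4 - (a * x + b * y + c * z) ^ 2)
        hl' hm' hA hKc hpos hdet (by linear_combination C1) (by linear_combination C2)
      exact ⟨h1, h0⟩
  obtain ⟨key1, key0⟩ := key
  have hz : (32:ℝ) ≤ (8 - 3 * b * c - 5 * b ^ 2 + a * c + a * b - a ^ 2) ^ 2 * (4 - (b + c) ^ 2) -
      (2 - (b + c) ^ 2) ^ 2 * (34 + 8 * b * c - 15 * b ^ 2 - 2 * a * c + 8 * a * b) := by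
    have e : (8 - 3 * b * c - 5 * b ^ 2 + a * c + a * b - a ^ 2) ^ 2 * (4 - (b + c) ^ 2) -
        (2 - (b + c) ^ 2) ^ 2 * (34 + 8 * b * c - 15 * b ^ 2 - 2 * a * c + 8 * a * b) =
        (128 - 224 * b * c - 204 * b ^ 2 + 120 * b ^ 3 * c + 72 * b ^ 4 + 32 * a * c - 56 * a * b - 24 * a * b ^ 2 * c + 24 * a * b ^ 3 + 36 * a ^ 2 + 132 * a ^ 2 * b * c + 12 * a ^ 2 * b ^ 2 + 12 * a ^ 3 * c + 36 * a ^ 3 * b - 48 * a ^ 4) + (4 - 34 * c ^ 2 - 72 * b * c - 8 * b * c ^ 3 - 6 * b ^ 2 - 26 * b ^ 2 * c ^ 2 - 28 * b ^ 3 * c - 10 * b ^ 4 - 20 * a * c + 2 * a * c ^ 3 - 44 * a * b + 6 * a * b * c ^ 2 + 6 * a * b ^ 2 * c + 2 * a * b ^ 3 + 52 * a ^ 2 - a ^ 2 * c ^ 2 - 2 * a ^ 2 * b * c - a ^ 2 * b ^ 2) * (a ^ 2 + b ^ 2 + c ^ 2 - 2) := by ring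
    have hh : a ^ 2 + b ^ 2 + c ^ 2 - 2 = 0 := by linarith only [hn]
    rw [e, hh, mul_zero, add_zero]
    exact cert_f13 hn hg1 hg2 hg3 hg4
  obtain ⟨d, hd⟩ : ∃ s, s = a * x + b * y + c * z := ⟨_, rfl⟩
  rw [← hd] at key1 key0 hdT
  have h4d : 0 ≤ 4 - d ^ 2 := by
    rw [hd]; nlinarith only [sq_nonneg (a - x), sq_nonneg (b - y), sq_nonneg (c - z), sq_nonneg (a + x), sq_nonneg (b + y), sq_nonneg (c + z), hn, hu]
  refine poleCap_false (w₁ := 0) (w₂ := 1) (w₃ := 1) (T₀ := b + c) hn hu hd.symm hT0 hII hdT (by linarith only [hUW1])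
    (by linarith only [key0]) ?_
  nlinarith only [mul_le_mul_of_nonneg_right hz h4d, mul_le_mul_of_nonneg_left key1 hA.le, hKK, h4d, hA]


end Summit.Ventures.Crystal3D.Theorems
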